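import Summits.ResolutionOfSingularities.ResolutionOfSingularities.Theorems.StrictDrop.Negative.FalseWithoutIsFractionRing
import HarnessLib

/-!
# Disproof of `StrictDrop` (stmt-ResolutionOfSingularities-16485) — findings

Work file of the crux disprover (refuter-cdisprove seat), route `HomologicalConductor`, crux #4
`StrictDrop`: along the canonical normalised `ca`-tower `T₀ = A_centre`,
`T_(m+1) = (normalisation of T_m[ca(T_m)/x])_centre`, while `T_m` is singular the minimal conductor
value eventually drops strictly.

## Findings (cycle 1, 2026-08-17) — NO KILL of the crux as stated; two load-bearing hypotheses nailed (`A.FG`, `IsFractionRing`)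

* **Elaboration / junk audit (clean).** `ca` is the genuine Iyengar–Takahashi annihilator: the
  `•` on `Ext` is `CategoryTheory.Abelian.Ext.instModule` over `ModuleCat.instLinear ↥A`, `HasExt`
  is `instHasExtModuleCatOfSmall` (probe `W.lean`, `#synth`). `0⁻¹ = 0` junk is harmless (`s = 0`
  contributes `y = 0` to `loc`; `x ≠ 0` is demanded in `chart` and in the conclusion). The
  hypothesis `∀ c : k, algebraMap k K c ∈ O` is REDUNDANT given `A.toSubring ≤ O.toSubring`
  (`algebraMap k K c ∈ A`). In the intended regime every stage is a noetherian local domain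
  essentially of finite type, `¬ IsRegularLocalRing T_m` means "singular", `ca(T_m) ⊆ 𝔪` then
  (tree: `cohomologyAnnihilator_le_maximalIdeal_of_not_isRegularLocalRing`) and a REGULAR later
  stage gives the witness `y = 1`; so `StrictDrop` ⇐ termination of the tower, and
  `¬ StrictDrop` ⇒ a valuation along which the canonical tower NEVER terminates. A refutation in
  the intended regime is therefore a forced infinite normalised `ca`-blow-up tower — an uncomputed
  object (no CAS on kit; `ca` is known in print only for ADE / curves / regular rings).
* **(a) `A.FG` is load-bearing — PROVED, sorry-free** (`strictDrop_false_without_FG`, axioms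
  `propext`, `Classical.choice`, `Quot.sound`): drop `A.FG` and take `A = O` = the valuation ring of
  `𝔽₂((t^ℚ))` (Hahn series, value group `ℚ`): `loc`, `chart`, `nrm` fix `A`, the tower is frozen at
  the non-noetherian stage `T₀ = O`, and a frozen non-regular stage violates the conclusion.
* **Structural lemma — PROVED** (`not_conclusion_of_frozen`, `frozen_regular_of_strictDrop`): a
  stationary stage `T_(n+1) = T_n` that is not regular kills the conclusion at `m = n` (witness
  `x = y`, no `ca` computation). Hence `StrictDrop` IMPLIES the lead's `stub_stationary_regular`
  (frozen ⇒ regular) even without its `Shape` hypothesis: that stub is NECESSARY. Any future kill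
  of the crux is either a frozen singular stage (excluded in the f.g. regime iff IT14 Thm 5.4 +
  `R₁`, the lead's SB) or an infinite strictly increasing tower at constant minimal value.
* **(a') `IsFractionRing ↥A K` is load-bearing — PROVED, sorry-free, LANDED (p157056 helper
  `…/Negative/FalseWithoutIsFractionRingHahn.lean` ACCEPTED; p157935 main
  `…/Negative/FalseWithoutIsFractionRing.lean` ACCEPTED, commit 55efe4bd01c7):** drop `IsFractionRing ↥A K` and take
  `K = 𝔽₂(t^{1/2^∞})` (perfect closure of `𝔽₂(t)` inside `𝔽₂((t^ℚ))`), `A = 𝔽₂[t] ⊆ O` = pulled-back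
  `t`-adic valuation ring: by Frobenius every `y ∈ O` satisfies `y^(2^E) = F₁(t)/G₁(t)` with
  `G₁(0) ≠ 0`, an element of the first stage, so `y` is integral over it and the normalisation IN
  `K` swallows `O`: the tower is frozen at the non-noetherian `T₁ = O` (here re-exported as
  `strictDrop_false_without_isFractionRing`).
* **Other hypotheses.** `A.toSubring ≤ O.toSubring` dropped: for rank-one `O` the statement
  becomes VACUOUS (`loc O A = K` as soon as some `a ∈ A` has `v(a) < 0`: every `f ∈ A ∖ 0` divides
  a `v`-negative element), higher rank unexplored; `p.Prime` / `CharP k p`: not load-bearing for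
  truth or falsity (the tower is characteristic-free), cannot be attacked.
* **Degenerate instances (all vacuous or true, recorded for the provers):** `O = ⊤` (trivial
  valuation) ⇒ every stage is the field `K` ⇒ regular ⇒ vacuous; `trdeg_k K ≤ 1` ⇒ `T₁` is a DVR or
  a field (Krull–Akizuki) ⇒ true with `y = 1`; centre of `O` of height `≤ 1` on a normal stage ⇒
  regular ⇒ vacuous; regular `T_m` ⇒ `ca = ⊤`, `chart = nrm = loc = id` (no junk progress).
* **Small / finite models:** none exist (finite `K` or `K/k` algebraic forces `O = K`).
* **LANDED (p155177, ACCEPTED, commit 0780f19c697f):**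
  `Summits/…/Theorems/StrictDrop/Negative/FalseWithoutFG.lean` — `strictDrop_false_without_FG`,
  `not_drop_of_frozen`, `natRec_frozen`, `natRec_const`, `loc_eq_self`, `chart_eq_self`,
  `nrm_eq_self` and the Hahn-series witness lemmas (namespace
  `Summit.ResolutionOfSingularities.ResolutionOfSingularities.Theorems.StrictDrop.Negative`; the
  statements there are spelled out without definitions, here they are over the named tower).
* **COMPUTATION — toric surfaces (evidence `ToricEvidence.md` on the item; scripts `catower.py`,
  `track.py`):** for EVERY cyclic quotient surface singularity `1/d(1,a)`, `d ≤ 100` (1691 types; `k`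
  algebraically closed, `p ∤ d`; `ca = ⋂_j stann(M_j)` over the conic modules recurring in high
  syzygies, `stann(M_j)` = trace ideal = monomials above the staircase of `M_j`; normalised blow-up
  of the monomial ideal `ca` = Newton-polygon fan) the index STRICTLY DROPS at every step of the
  canonical tower, there is no cycle in the type digraph, and the tower has length `≤ 6` (`A_99`):
  NO toric-surface counterexample to `StrictDrop` / `SurfaceTermination` (sanity: `A_n ↦` two
  `A_{⌈n/2⌉-1}`, `ca(A_n) = (u, w, z^⌈n/2⌉)` as on the route card; `ca(1/3(1,1)) = 𝔪`).
* **Natural strengthening "immediate drop" (`m' = m + 1`) is FALSE (by the same computation, not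
  formalised):** in 308 of 2934 random (type, valuation) runs with `d ≤ 40` some singular stage has
  `γ_(m+1) = γ_m`; extreme case `A_39` along the monomial valuation `v(x) = 1`, `v(y) = 1/1000`:
  `A_39 → A_19 → A_9 → A_4 → A_1 → regular` with `γ = min v(ca) = 1/25` CONSTANT through all five
  singular stages and dropping (to `0`) only at the regular stage. So `γ` is NOT a step-Lyapunov
  function of the tower — progress is invisible to the conductor value until termination; in these
  runs `StrictDrop` holds exactly because the tower terminates. Provers: do not attempt the
  `m' = m + 1` form (`StrictDropImmediate` below); NoZeno's "γ decreases" carries no information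
  before the last step.

## How to read this file
Section "Tower": the route's `let`s named (same names as `Lines/birth.lean`). Then the structural
lemmas, the unfolding `strictDrop_iff`, (a) the `A.FG` analysis with its Hahn-series witness
(namespace `WithoutFG`), (a') the `IsFractionRing` near-miss.
-/

noncomputable section

-- single-problem summit: the doubled namespace component `ResolutionOfSingularities` is forced
set_option linter.dupNamespace false

open Summit.ResolutionOfSingularities.ResolutionOfSingularities.Theses.HomologicalConductor (StrictDrop)

namespace Summit.ResolutionOfSingularities.ResolutionOfSingularities.Cruxes.StrictDrop.Disproof

/-! ## The canonical tower, named (verbatim the `let`s of the route file; same names as the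
lead's `Lines/birth.lean`, so that statements can be compared textually) -/

section Tower

variable {k K : Type} [Field k] [Field K] [Algebra k K]

/-- The inline cohomology annihilator of the route file (image in `K` of `ca(A)`). [cite: IyengarTakahashi2014, Def. 2.1] -/
def ca (A : Subalgebra k K) : Set K :=
  {x : K | ∃ hx : x ∈ A, ∃ n : ℕ, ∀ i : ℕ, n ≤ i → ∀ (M N : ModuleCat.{0} ↥A),
    Module.Finite ↥A M → Module.Finite ↥A N →
      ∀ e : CategoryTheory.Abelian.Ext.{0} M N i, (⟨x, hx⟩ : ↥A) • e = 0}

/-- `loc O A` = `A` localised at the centre of `O`. [folklore] -/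
def loc (O : ValuationSubring K) (A : Subalgebra k K) : Subalgebra k K :=
  Algebra.adjoin k {y : K | ∃ a ∈ A, ∃ s ∈ A, s⁻¹ ∈ O ∧ y = a * s⁻¹}

/-- `chart O A` = the affine chart `A[ca(A)/x]` of the blow-up of `ca(A)` through which `O` passes. [folklore] -/
def chart (O : ValuationSubring K) (A : Subalgebra k K) : Subalgebra k K :=
  Algebra.adjoin k ((A : Set K) ∪ {y : K | ∃ c ∈ ca A, ∃ x ∈ ca A, x ≠ 0 ∧
    (∀ c' ∈ ca A, c' * x⁻¹ ∈ O) ∧ y = c * x⁻¹})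

/-- `nrm B` = the normalisation of `B` inside `K`. [folklore] -/
def nrm (B : Subalgebra k K) : Subalgebra k K :=
  Algebra.adjoin k {y : K | IsIntegral ↥B y}

/-- The canonical normalised `ca`-tower along `O`. [folklore] -/
def tower (O : ValuationSubring K) (A : Subalgebra k K) (m : ℕ) : Subalgebra k K :=
  @Nat.rec (fun _ => Subalgebra k K) (loc O A) (fun _ B => loc O (nrm (chart O B))) m

@[simp] theorem tower_zero (O : ValuationSubring K) (A : Subalgebra k K) :
    tower O A 0 = loc O A := rfl

@[simp] theorem tower_succ (O : ValuationSubring K) (A : Subalgebra k K) (m : ℕ) :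
    tower O A (m + 1) = loc O (nrm (chart O (tower O A m))) := rfl

/-- `A ⊆ loc O A`. [folklore] -/
theorem le_loc (O : ValuationSubring K) (A : Subalgebra k K) : A ≤ loc O A := by
  intro a ha
  refine Algebra.subset_adjoin ?_
  exact ⟨a, ha, 1, A.one_mem, by simp, by simp⟩

/-- `A ⊆ chart O A`. [folklore] -/
theorem le_chart (O : ValuationSubring K) (A : Subalgebra k K) : A ≤ chart O A := by
  intro a ha
  exact Algebra.subset_adjoin (Or.inl ha)

/-- `B ⊆ nrm B`. [folklore] -/
theorem le_nrm (B : Subalgebra k K) : B ≤ nrm B := by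
  intro b hb
  refine Algebra.subset_adjoin ?_
  show IsIntegral (↥B) b
  have : b = algebraMap (↥B) K ⟨b, hb⟩ := rfl
  rw [this]
  exact isIntegral_algebraMap

/-- `loc O A = A` as soon as `A` is local at the centre of `O` (every element of `A` that is a
unit of `O` is a unit of `A`) and `A ⊆ O`. [folklore] -/
theorem loc_eq_self (O : ValuationSubring K) (A : Subalgebra k K)
    (hAO : ∀ x ∈ A, x ∈ O) (hunit : ∀ s ∈ A, s⁻¹ ∈ O → s⁻¹ ∈ A) : loc O A = A := by
  refine le_antisymm ?_ (le_loc O A)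
  refine Algebra.adjoin_le ?_
  rintro y ⟨a, ha, s, hs, hsO, rfl⟩
  have _ := hAO a ha
  exact A.mul_mem ha (hunit s hs hsO)

/-- `chart O A = A` as soon as `O ⊆ A` (the chart adjoins only elements of `O`). [folklore] -/
theorem chart_eq_self (O : ValuationSubring K) (A : Subalgebra k K)
    (hOA : ∀ x ∈ O, x ∈ A) : chart O A = A := by
  refine le_antisymm ?_ (le_chart O A)
  refine Algebra.adjoin_le ?_
  rintro y (hy | ⟨c, hc, x, _, _, hxmin, rfl⟩)
  · exact hy
  · exact hOA _ (hxmin c hc)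

/-- `nrm A = A` as soon as `A` is integrally closed in `K`. [folklore] -/
theorem nrm_eq_self (A : Subalgebra k K) (hint : ∀ y : K, IsIntegral ↥A y → y ∈ A) :
    nrm A = A := by
  refine le_antisymm ?_ (le_nrm A)
  refine Algebra.adjoin_le ?_
  intro y hy
  exact hint y hy

/-- The chart only adjoins elements of `O`: `chart O A ⊆ O`-generated, precisely
`chart O A ≤ Algebra.adjoin k (A ∪ O)`. [folklore] -/
theorem chart_le (O : ValuationSubring K) (A : Subalgebra k K) :
    chart O A ≤ Algebra.adjoin k ((A : Set K) ∪ (O : Set K)) := by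
  refine Algebra.adjoin_mono ?_
  rintro y (hy | ⟨c, hc, x, _, _, hxmin, rfl⟩)
  · exact Or.inl hy
  · exact Or.inr (hxmin c hc)

/-- **Frozen towers stay frozen**: if stage `n` is stationary then every later stage equals
stage `n`. [folklore] -/
theorem tower_eq_of_frozen (O : ValuationSubring K) (A : Subalgebra k K) {n : ℕ}
    (h : tower O A (n + 1) = tower O A n) : ∀ m, n ≤ m → tower O A m = tower O A n := by
  intro m hm
  obtain ⟨d, rfl⟩ := Nat.exists_eq_add_of_le hm
  induction d with
  | zero => rfl
  | succ d ih =>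
    have ih' := ih (Nat.le_add_right n d)
    calc tower O A (n + (d + 1)) = tower O A (n + d + 1) := by rw [Nat.add_assoc]
      _ = loc O (nrm (chart O (tower O A (n + d)))) := rfl
      _ = loc O (nrm (chart O (tower O A n))) := by rw [ih']
      _ = tower O A (n + 1) := rfl
      _ = tower O A n := h

/-- The conclusion of the crux at one input `(O, A)`, over the named tower (the part after the
hypotheses; `StrictDrop` is `∀ inputs, hypotheses → Conclusion O A` by `strictDrop_iff`). [folklore] -/
def Conclusion (O : ValuationSubring K) (A : Subalgebra k K) : Prop :=
  ∀ m : ℕ, ¬ IsRegularLocalRing ↥(tower O A m) → ∃ m' : ℕ, m < m' ∧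
    ∃ y ∈ ca (tower O A m'), y ≠ 0 ∧ ∀ x ∈ ca (tower O A m), x ≠ 0 → y * x⁻¹ ∉ O

/-- **A frozen singular stage kills the crux conclusion** (no `ca` computation needed): if
`T_(n+1) = T_n` and `T_n` is not a regular local ring, then the conclusion fails at `m = n` —
every later stage is `T_n` itself, and the witness `y ∈ ca(T_n) ∖ 0` would need `v(y) < v(y)`.
Consequently `StrictDrop` IMPLIES the lead's `stub_stationary_regular` (frozen ⇒ regular):
that stub is necessary, not only sufficient. [folklore] -/
theorem not_conclusion_of_frozen (O : ValuationSubring K) (A : Subalgebra k K) {n : ℕ}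
    (hfrozen : tower O A (n + 1) = tower O A n) (hsing : ¬ IsRegularLocalRing ↥(tower O A n)) :
    ¬ Conclusion O A := by
  intro hC
  obtain ⟨m', hlt, y, hy, hy0, hval⟩ := hC n hsing
  rw [tower_eq_of_frozen O A hfrozen m' hlt.le] at hy
  exact hval y hy hy0 (by rw [mul_inv_cancel₀ hy0]; exact O.one_mem)

end Tower

/-! ## The crux, unfolded over the named tower (definitional) -/

/-- `StrictDrop` with its `let`s replaced by the named tower (`Iff.rfl`). [folklore] -/
theorem strictDrop_iff : StrictDrop ↔
    ∀ p : ℕ, p.Prime → ∀ (k K : Type) [Field k] [CharP k p] [Field K] [Algebra k K]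
      (O : ValuationSubring K) (A : Subalgebra k K), (∀ c : k, algebraMap k K c ∈ O) → A.FG →
      IsFractionRing ↥A K → A.toSubring ≤ O.toSubring → Conclusion O A :=
  Iff.rfl

/-- **`StrictDrop` forces every frozen stage to be regular** (the lead's `Sig.stub_stationary_regular`
without its `Shape` hypothesis is a CONSEQUENCE of the crux): a stationary singular stage anywhere
along any valuation refutes `StrictDrop`. [folklore] -/
theorem frozen_regular_of_strictDrop (h : StrictDrop) :
    ∀ p : ℕ, p.Prime → ∀ (k K : Type) [Field k] [CharP k p] [Field K] [Algebra k K]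
      (O : ValuationSubring K) (A : Subalgebra k K), (∀ c : k, algebraMap k K c ∈ O) → A.FG →
      IsFractionRing ↥A K → A.toSubring ≤ O.toSubring →
      ∀ n : ℕ, tower O A (n + 1) = tower O A n → IsRegularLocalRing ↥(tower O A n) := by
  intro p hp k K _ _ _ _ O A hk hfg hfrac hle n hfrozen
  by_contra hsing
  exact not_conclusion_of_frozen O A hfrozen hsing (strictDrop_iff.mp h p hp k K O A hk hfg hfrac hle)

/-! ## (a) Load-bearing analysis — hypothesis `A.FG` (finite generation over the field)

Dropping `A.FG` makes the crux FALSE: take `A = O` itself for a NON-DISCRETE valuation ring `O`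
(here the `t`-adic valuation ring of the Hahn-series field `𝔽₂((t^ℚ))`, value group `ℚ`).
Then `loc`, `chart`, `nrm` all fix `A` (a valuation ring is local at its own centre, the chart
adjoins only elements of `O = A`, and valuation rings are integrally closed), so the tower is
FROZEN at stage `0` at a ring that is not noetherian, hence not `IsRegularLocalRing`; by
`not_conclusion_of_frozen` the conclusion fails (witness `x = y`). Moral for provers: the only
thing that makes "`¬ IsRegularLocalRing T_m`" mean "singular" rather than "junk (non-noetherian)"
is the finite generation of `A` propagated along the tower (the lead's `stub_towerShape`, route
constraint C4); no cohomology annihilator needs to be computed to see this. -/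

namespace WithoutFG

/-- The field `𝔽₂((t^ℚ))` of Hahn series with rational exponents. -/
abbrev K : Type := HahnSeries ℚ (ZMod 2)

/-- Its `t`-adic (order) valuation, value group `ℚ`. -/
def v : AddValuation K (WithTop ℚ) := HahnSeries.addVal ℚ (ZMod 2)

theorem v_apply (x : K) : v x = x.orderTop := HahnSeries.addVal_apply

/-- The valuation ring `O = {f | 0 ≤ ord f}` — non-discrete of rank one. -/
def O : ValuationSubring K := (AddValuation.toValuation v).valuationSubring

theorem mem_O_iff {x : K} : x ∈ O ↔ 0 ≤ v x := Iff.rfl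

theorem single_mem_O {q : ℚ} (hq : 0 ≤ q) (r : ZMod 2) : HahnSeries.single q r ∈ O := by
  rw [mem_O_iff, v_apply]
  exact (WithTop.coe_le_coe.mpr hq).trans HahnSeries.orderTop_single_le

/-- `𝔽₂ ⊆ O`: the image of `c ∈ 𝔽₂ = {0, 1}` is `0` or `1`. -/
theorem algebraMap_mem_O (c : ZMod 2) : algebraMap (ZMod 2) K c ∈ O := by
  have hc : ∀ c : ZMod 2, c = 0 ∨ c = 1 := by decide
  rcases hc c with rfl | rfl
  · rw [map_zero]; exact O.zero_mem
  · rw [map_one]; exact O.one_mem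

/-- `O` as a `𝔽₂`-subalgebra of `K` (same carrier). -/
def A : Subalgebra (ZMod 2) K :=
  { O.toSubring with
    algebraMap_mem' := fun c => algebraMap_mem_O c }

theorem mem_A_iff {x : K} : x ∈ A ↔ x ∈ O := Iff.rfl

theorem A_le_O : A.toSubring ≤ O.toSubring := fun _ hx => hx

theorem isFractionRing_A : IsFractionRing ↥A K where
  map_units := fun ⟨y, hy⟩ =>
    (Units.mk0 (y : K) fun c => nonZeroDivisors.ne_zero hy <| Subtype.ext c).isUnit
  surj z := by
    by_cases h : z = 0
    · exact ⟨(0, 1), by simp [h]⟩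
    rcases O.mem_or_inv_mem z with hh | hh
    · exact ⟨(⟨z, hh⟩, 1), by simp⟩
    · refine ⟨⟨1, ⟨⟨_, hh⟩, ?_⟩⟩, ?_⟩
      · exact mem_nonZeroDivisors_iff_ne_zero.2 fun c => h (inv_eq_zero.mp (congr_arg Subtype.val c))
      · simp [mul_inv_cancel₀ h]
  exists_of_eq {a b} h := ⟨1, by
    have : (a : K) = b := by simpa using h
    simpa using Subtype.ext this⟩

theorem integers_A : (AddValuation.toValuation v).Integers ↥A where
  hom_inj := Subtype.coe_injective
  map_le_one := fun r => r.2
  exists_of_le_one := fun r hr => ⟨⟨r, hr⟩, rfl⟩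

theorem mem_A_of_isIntegral {y : K} (hy : IsIntegral ↥A y) : y ∈ A :=
  integers_A.mem_of_integral hy

/-- The elements `t^(1/2^n)`. -/
def t (n : ℕ) : ↥A :=
  ⟨HahnSeries.single ((1 : ℚ) / 2 ^ n) (1 : ZMod 2), single_mem_O (by positivity) 1⟩

theorem t_succ_mul_t_succ (n : ℕ) : t (n + 1) * t (n + 1) = t n := by
  apply Subtype.ext
  show HahnSeries.single _ _ * HahnSeries.single _ _ = HahnSeries.single _ _
  have hq : (1 : ℚ) / 2 ^ (n + 1) + 1 / 2 ^ (n + 1) = 1 / 2 ^ n := by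
    rw [pow_succ]; field_simp; norm_num
  rw [HahnSeries.single_mul_single, mul_one, hq]

/-- The strictly increasing chain of principal ideals `(t^(1/2^n))`. -/
def chain : ℕ →o Ideal ↥A where
  toFun n := Ideal.span {t n}
  monotone' := monotone_nat_of_le_succ fun n =>
    Ideal.span_singleton_le_span_singleton.mpr ⟨t (n + 1), (t_succ_mul_t_succ n).symm⟩

theorem not_isNoetherianRing_A : ¬ IsNoetherianRing ↥A := by
  intro hN
  obtain ⟨n, hn⟩ := (monotone_stabilizes_iff_noetherian.mpr hN) chain
  have hmem : t (n + 1) ∈ Ideal.span {t n} := by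
    have : chain n = chain (n + 1) := hn (n + 1) (Nat.le_succ n)
    change t (n + 1) ∈ chain n
    rw [this]
    exact Ideal.subset_span rfl
  obtain ⟨g, hg⟩ := Ideal.mem_span_singleton'.mp hmem
  have hgK : (g : K) * HahnSeries.single ((1 : ℚ) / 2 ^ n) 1 =
      HahnSeries.single ((1 : ℚ) / 2 ^ (n + 1)) 1 := congr_arg Subtype.val hg
  have hg0 : (g : K) ≠ 0 := by
    intro h0
    rw [h0, zero_mul] at hgK
    exact HahnSeries.single_ne_zero one_ne_zero hgK.symm
  have hord := congr_arg HahnSeries.order hgK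
  rw [HahnSeries.order_mul hg0 (HahnSeries.single_ne_zero one_ne_zero),
    HahnSeries.order_single one_ne_zero, HahnSeries.order_single one_ne_zero] at hord
  have hgv : 0 ≤ (g : K).order := by
    have := g.2
    rw [mem_A_iff, mem_O_iff, v_apply, ← HahnSeries.order_eq_orderTop_of_ne_zero hg0,
      ← WithTop.coe_zero, WithTop.coe_le_coe] at this
    exact this
  have hlt : (1 : ℚ) / 2 ^ (n + 1) < 1 / 2 ^ n := by
    apply one_div_lt_one_div_of_lt (by positivity)
    exact pow_lt_pow_right₀ (by norm_num) (Nat.lt_succ_self n)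
  linarith

theorem not_isRegularLocalRing_A : ¬ IsRegularLocalRing ↥A := by
  intro h
  exact not_isNoetherianRing_A inferInstance


/-- Every stage of the canonical tower of `(O, A = O)` is `A` itself: the tower is frozen from
stage `0` on. [folklore] -/
theorem tower_eq (m : ℕ) : tower O A m = A := by
  have hloc : loc O A = A := loc_eq_self O A (fun _ hx => hx) (fun _ _ h => h)
  have hchart : chart O A = A := chart_eq_self O A (fun _ hx => hx)
  have hnrm : nrm A = A := nrm_eq_self A (fun _ hy => mem_A_of_isIntegral hy)
  induction m with
  | zero => exact hloc
  | succ m ih => rw [tower_succ, ih, hchart, hnrm, hloc]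

end WithoutFG

/-- `StrictDrop` with the hypothesis `A.FG` DROPPED (verbatim the crux minus `A.FG →`). [folklore] -/
def StrictDropWithoutFG : Prop :=
  ∀ p : ℕ, p.Prime → ∀ (k K : Type) [Field k] [CharP k p] [Field K] [Algebra k K] (O : ValuationSubring K) (A : Subalgebra k K), (∀ c : k, algebraMap k K c ∈ O) → IsFractionRing ↥A K → A.toSubring ≤ O.toSubring → let ca : Subalgebra k K → Set K := fun A => {x : K | ∃ hx : x ∈ A, ∃ n : ℕ, ∀ i : ℕ, n ≤ i → ∀ (M N : ModuleCat.{0} ↥A), Module.Finite ↥A M → Module.Finite ↥A N → ∀ e : CategoryTheory.Abelian.Ext.{0} M N i, (⟨x, hx⟩ : ↥A) • e = 0}; let loc : Subalgebra k K → Subalgebra k K := fun A => Algebra.adjoin k {y : K | ∃ a ∈ A, ∃ s ∈ A, s⁻¹ ∈ O ∧ y = a * s⁻¹}; let chart : Subalgebra k K → Subalgebra k K := fun A => Algebra.adjoin k ((A : Set K) ∪ {y : K | ∃ c ∈ ca A, ∃ x ∈ ca A, x ≠ 0 ∧ (∀ c' ∈ ca A, c' * x⁻¹ ∈ O) ∧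 y = c * x⁻¹}); let nrm : Subalgebra k K → Subalgebra k K := fun B => Algebra.adjoin k {y : K | IsIntegral ↥B y}; let tower : Subalgebra k K → ℕ → Subalgebra k K := fun A m => @Nat.rec (fun _ => Subalgebra k K) (loc A) (fun _ B => loc (nrm (chart B))) m; ∀ m : ℕ, ¬ IsRegularLocalRing ↥(tower A m) → ∃ m' : ℕ, m < m' ∧ ∃ y ∈ ca (tower A m'), y ≠ 0 ∧ ∀ x ∈ ca (tower A m), x ≠ 0 → y * x⁻¹ ∉ O

/-- **Any proof of `StrictDrop` must use `A.FG`**: without finite generation the crux is false —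
witness `p = 2`, `k = 𝔽₂`, `K = 𝔽₂((t^ℚ))` (Hahn series, exponents in `ℚ`), `O` its valuation
ring, `A = O`: the tower is frozen at the non-noetherian (hence non-regular) stage `T₀ = O`, and a
frozen non-regular stage violates the conclusion (`not_conclusion_of_frozen`, witness `x = y`).
[folklore] -/
theorem strictDrop_false_without_FG : ¬ StrictDropWithoutFG := by
  intro h
  have key : Conclusion WithoutFG.O WithoutFG.A :=
    h 2 Nat.prime_two (ZMod 2) WithoutFG.K WithoutFG.O WithoutFG.A WithoutFG.algebraMap_mem_O
      WithoutFG.isFractionRing_A WithoutFG.A_le_O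
  refine not_conclusion_of_frozen WithoutFG.O WithoutFG.A (n := 0) ?_ ?_ key
  · rw [WithoutFG.tower_eq 1, WithoutFG.tower_eq 0]
  · rw [WithoutFG.tower_eq 0]
    exact WithoutFG.not_isRegularLocalRing_A

/-! ## (a') Load-bearing analysis — hypothesis `IsFractionRing ↥A K` (near-miss, open) -/

/-- `StrictDrop` with the hypothesis `IsFractionRing ↥A K` DROPPED (verbatim the crux minus
`IsFractionRing ↥A K →`): `K` may then be a proper overfield of `Frac A`, and `nrm` takes the
integral closure in `K`. [folklore] -/
def StrictDropWithoutIsFractionRing : Prop :=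
  ∀ p : ℕ, p.Prime → ∀ (k K : Type) [Field k] [CharP k p] [Field K] [Algebra k K] (O : ValuationSubring K) (A : Subalgebra k K), (∀ c : k, algebraMap k K c ∈ O) → A.FG → A.toSubring ≤ O.toSubring → let ca : Subalgebra k K → Set K := fun A => {x : K | ∃ hx : x ∈ A, ∃ n : ℕ, ∀ i : ℕ, n ≤ i → ∀ (M N : ModuleCat.{0} ↥A), Module.Finite ↥A M → Module.Finite ↥A N → ∀ e : CategoryTheory.Abelian.Ext.{0} M N i, (⟨x, hx⟩ : ↥A) • e = 0}; let loc : Subalgebra k K → Subalgebra k K := fun A => Algebra.adjoin k {y : K | ∃ a ∈ A, ∃ s ∈ A, s⁻¹ ∈ O ∧ y = a * s⁻¹}; let chart : Subalgebra k K → Subalgebra k K := fun A => Algebra.adjoin k ((A : Set K) ∪ {y : K | ∃ c ∈ ca A, ∃ x ∈ ca A, x ≠ 0 ∧ (∀ c' ∈ ca A, c' * x⁻¹ ∈ O) ∧ y = c * x⁻¹}); let nrm : Subalgebra k K → Subalgebra k K := fun B => Algebra.adjoin k {y : K | IsIntegral ↥B y}; let tower : Subalgebra k K → ℕ → Subalgebra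 k K := fun A m => @Nat.rec (fun _ => Subalgebra k K) (loc A) (fun _ B => loc (nrm (chart B))) m; ∀ m : ℕ, ¬ IsRegularLocalRing ↥(tower A m) → ∃ m' : ℕ, m < m' ∧ ∃ y ∈ ca (tower A m'), y ≠ 0 ∧ ∀ x ∈ ca (tower A m), x ≠ 0 → y * x⁻¹ ∉ O

/-- **Any proof of `StrictDrop` must use `IsFractionRing ↥A K`** — the landed theorem
`Theorems.StrictDrop.Negative.strictDrop_false_without_isFractionRing` (perfect-closure witness,
see the module docstring), re-exported over the named statement. [folklore] -/
theorem strictDrop_false_without_isFractionRing : ¬ StrictDropWithoutIsFractionRing :=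
  Summit.ResolutionOfSingularities.ResolutionOfSingularities.Theorems.StrictDrop.Negative.strictDrop_false_without_isFractionRing

/-! ## Remarks (proved): redundancy of `∀ c : k, algebraMap k K c ∈ O` -/

/-- The hypothesis `∀ c : k, algebraMap k K c ∈ O` of the crux follows from
`A.toSubring ≤ O.toSubring` (information for the prover: it can be discharged, never used).
[folklore] -/
theorem algebraMap_mem_of_le {k K : Type} [Field k] [Field K] [Algebra k K]
    (O : ValuationSubring K) (A : Subalgebra k K) (hle : A.toSubring ≤ O.toSubring) (c : k) :
    algebraMap k K c ∈ O :=
  hle (A.algebraMap_mem c)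

end Summit.ResolutionOfSingularities.ResolutionOfSingularities.Cruxes.StrictDrop.Disproof

end
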